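import Summits.QuantumFields.QCD.Theses.TransparentRPWall
import Literature.MathematicalPhysics.QuantumFieldTheory.TiltedTorusLatticeSchwinger
import Literature.MathematicalPhysics.QuantumFieldTheory.QCDAsymptoticScalingCouplingDivergence
import Summits.QuantumFields.YangMills.Theorems.PencilRigidityDiagonalMirrorRPRStubRpClosureDefs
import Summits.QuantumFields.YangMills.Theorems.PencilRigidityDiagonalMirrorRPRStubRpClosureSupport
import Summits.QuantumFields.YangMills.Theorems.PencilRigidityDiagonalMirrorRPRStubRpClosureDensity
import HarnessLib.Audit

/-!
# `DiagonalRPClosure` — birth skeleton (piece X_C of the BC2 redirect of `TransparentRPWall.WallDiagonalRP`, stmt-QuantumFields-10466)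

Crux-strategist planner-cstrat-stmt-QuantumFields-10466-r1-0, 2026-08-17.  Piece X_C = MODEL-BLIND RP closure in a canonical
diagonal frame, any label type: exactly-swap-RP approximants converging to a normalised labelled family on compact disjoint real
tensors force E2 of the pull-back by every frame `R e₀ = c (e₀ − e₁)`, `c > 0`.  PROVABLE NOW (L): it is the labelled port of the
LANDED one-species YangMills theorem `RpClosure.isReflectionPositive_pullback` (Theorems/PencilRigidityDiagonalMirrorRPRStubRpClosure.lean,
crux DiagonalMirrorRPR stmt-10604) with its model-specific lattice input (`psd_canonical`'s Gram-matrix limit) abstracted into the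
approximant hypotheses.

Stubs (the ONLY `sorry`s) — the sibling theorem's two halves:
* `stub_productPSD` — **(M) the limit step.**  In a canonical frame, on finite families of slab-ordered compact real products `P_I`
  (the LANDED dense class `RpClosure.slabOrderedCompactProducts`), the pulled-back Gram `∑ c̄_I c_J 𝔖(R·(ΘP_I* ⊗ P_J))` is real `≥ 0`:
  its entries are the test function `(ΘP_I* ⊗ P_J) ∘ R⁻¹` = a real tensor of `(f_{I,·} ∘ R⁻¹) ∘ swap` and `f_{J,·} ∘ R⁻¹`
  (LANDED frame algebra `RpClosure.frame_reflection`, `linActTest_thetaTest_apply`), compactly supported in `{x₁ < x₀}`, pairwise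
  disjoint (LANDED `append_slabs` / `isOffDiagonal_of_slabs`); degree `0` by E0 and the approximants' normalisation; so the entries
  are limits of the approximants' swap Gram matrices (hypothesis `conv`), eventually positive (hypothesis `rp`); `[0,∞) ⊆ ℂ` closed.
* `stub_rpOfProductPSD` — **(M) the density step, any labelled family.**  Gram positivity on slab-ordered compact real product
  families ⇒ E2, by continuity of each `𝔖ₙᵏ` and the LANDED ordered-wedge density with compact supports
  (`RpClosure.stub_rpClosure_density`), verbatim the closure argument of `isReflectionPositive_pullback` with label strings carried.
* `DiagonalRPClosure_of` — PROVED composition: instantiate the density step at the pulled-back family in a canonical frame, then the LANDED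
  frame normal form + transport along the proper-hypercubic invariance hypothesis give every diagonal frame.

-/

set_option autoImplicit false

noncomputable section

namespace Summit.QuantumFields.QCD.Cruxes.WallDiagonalRP.DiagonalRPClosureBirth

open scoped BigOperators Topology Classical ComplexConjugate SchwartzMap
open Filter Set Function MeasureTheory
open Literature.MathematicalPhysics.QuantumLattice Literature.MathematicalPhysics.AQFT
  Literature.MathematicalPhysics.QuantumFieldTheory Literature.Probability.LatticeModels

/-! ## §0 Vocabulary (verbatim the inline `let`s of the route items, given names) -/

/-- Euclidean `ℝ⁴`, time = coordinate `0`. -/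
abbrev E4 : Type := EuclideanSpace ℝ (Fin 4)

/-- **The wall-modified lattice QCD `n`-point functional on the FILS 45° cover** `T̃_{N_k}`, `N_k = sch.side k`
(chart `(u,w,y,z) = (x₀−x₁, x₁, x₂, x₃)`, walls `u = 0` and `u = N_k`): Wilson's `SU(3)` plaquette weight on the cover,
`N_f` Wilson quarks (`r = 1`, bare masses `m_f(k)`) whose hops in directions `0, 1` touching a wall are re-spun
`γ₀ ↦ +γ_n`, `γ₁ ↦ −γ_n`, `γ_n = (γ₀ − γ₁)/√2`, Berezin-integrated; the same smeared, rescaled, renormalised species fields as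
`qcdLatticeSchwinger` (box `[-L_k, L_k]⁴ ⊂ ℤ⁴`, `z_s(k) a_k⁴ ∑ f(a_k x)(O_s(x) − shift_s(k))`, glue read through the
`Λ̃`-periodic lift, mesons at the cover site); normalised by its own partition function; `1` in degree `0`. VERBATIM the
`Wfun` of the route items `CoverWallRP` / `WallTransparency`. -/
def wallFun : (Nf : ℕ) → QCDScheme Nf → ℕ → (n : ℕ) → (Fin n → QCDField Nf) → (Fin n → 𝓢(E4, ℝ)) → ℂ :=
  let E := EuclideanSpace ℝ (Fin 4);
  let SU3 := ↥(Matrix.specialUnitaryGroup (Fin 3) ℂ);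
  let γn : Matrix (Fin 4) (Fin 4) ℂ := (((Real.sqrt 2)⁻¹ : ℝ) : ℂ) • (euclideanGamma 0 - euclideanGamma 1);
  fun Nf sch k n σ f =>
      (let T := TiltedTorus.Site (sch.side k);
       let C := TiltedTorus.Config (sch.side k) SU3;
       let ρ := fundamentalRep (Fin 3);
       let V := Fin Nf × (T × Fin 3 × Fin 4);
       let I := Fin (Fintype.card V);
       let e : V ≃ I := Fintype.equivFin V;
       let A := GrassmannAlgebra ℂ (I ⊕ₗ I);
       let wall : T → Prop := fun x => x.1 = 0 ∨ x.1 = ((sch.side k : ℕ) : ZMod (2 * sch.side k));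
       let Γ : Fin 4 → T → T → Matrix (Fin 4) (Fin 4) ℂ :=
         fun μ x y => if (μ = 0 ∨ μ = 1) ∧ (wall x ∨ wall y) then (if μ = 0 then γn else -γn) else euclideanGamma μ;
       let D : C → Matrix I I ℂ := fun U => Matrix.reindex e e (Matrix.of fun v w =>
         if v.1 = w.1 then
           ((if v.2 = w.2 then ((sch.mq v.1 k + 4 : ℝ) : ℂ) else 0) -
             (1 / 2 : ℂ) * ∑ μ : Fin 4,
               ((if w.2.1 = v.2.1 + TiltedTorus.step μ then
                   (1 - Γ μ v.2.1 w.2.1) v.2.2.2 w.2.2.2 * ρ (U (v.2.1, μ)) v.2.2.1 w.2.2.1 else 0) +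
                (if v.2.1 = w.2.1 + TiltedTorus.step μ then
                   (1 + Γ μ v.2.1 w.2.1) v.2.2.2 w.2.2.2 * ρ ((U (w.2.1, μ))⁻¹) v.2.2.1 w.2.2.1 else 0)))
         else 0);
       let boltz : C → A := fun U => grassmannExp (quadratic ℂ (-D U));
       let P : Fin Nf → Fin Nf → T → A := fun fl g x =>
         ∑ a : Fin 3, ∑ α : Fin 4, ∑ β : Fin 4,
           (Complex.I * gammaFive α β) • (psiBar ℂ (e (fl, (x, a, α))) * psi ℂ (e (g, (x, a, β))));
       let ins : C → QCDField Nf → Site 4 → A := fun U s x =>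
         let y := TiltedTorus.proj (sch.side k) x;
         match s with
         | .glue => algebraMap ℂ A ((actionDensity ρ (configShift (-x) (TiltedTorus.lift (sch.side k) U)) : ℝ) : ℂ)
         | .pseudoRe fl g => (1 / 2 : ℂ) • (P fl g y + P g fl y)
         | .pseudoIm fl g => (-Complex.I / 2) • (P fl g y - P g fl y);
       let sm : C → QCDField Nf → SchwartzMap E ℝ → A := fun U s h =>
         ∑ x ∈ box 4 (sch.L k), ((sch.z s k * sch.a k ^ 4 * h (sch.a k • siteToE x) : ℝ) : ℂ) •
           (ins U s x - algebraMap ℂ A ((sch.shift s k : ℝ) : ℂ));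
       let wt : C → ℂ := fun U => ((TiltedTorus.weight ρ (sch.β k) U : ℝ) : ℂ);
       let ber := GrassmannAlgebra.berezin ℂ (I ⊕ₗ I);
       let ν := (TiltedTorus.haar (sch.side k) : Measure C);
       if n = 0 then (1 : ℂ) else
         (∫ U, ber ((List.ofFn fun i => sm U (σ i) (f i)).prod * boltz U) * wt U ∂ν) /
           (∫ U, ber (boltz U) * wt U ∂ν))

/-- **The HONEST lattice QCD functional on the 45° cover** (no wall modification: `Γ_μ ≡ γ_μ`) — the same text with the wall
predicate `False`; the cover twin of `qcdLatticeSchwinger` (which lives on the cubic torus `ℤ⁴/(2L_k+1)ℤ⁴`). -/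
def coverFun : (Nf : ℕ) → QCDScheme Nf → ℕ → (n : ℕ) → (Fin n → QCDField Nf) → (Fin n → 𝓢(E4, ℝ)) → ℂ :=
  let E := EuclideanSpace ℝ (Fin 4);
  let SU3 := ↥(Matrix.specialUnitaryGroup (Fin 3) ℂ);
  let γn : Matrix (Fin 4) (Fin 4) ℂ := (((Real.sqrt 2)⁻¹ : ℝ) : ℂ) • (euclideanGamma 0 - euclideanGamma 1);
  fun Nf sch k n σ f =>
      (let T := TiltedTorus.Site (sch.side k);
       let C := TiltedTorus.Config (sch.side k) SU3;
       let ρ := fundamentalRep (Fin 3);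
       let V := Fin Nf × (T × Fin 3 × Fin 4);
       let I := Fin (Fintype.card V);
       let e : V ≃ I := Fintype.equivFin V;
       let A := GrassmannAlgebra ℂ (I ⊕ₗ I);
       let wall : T → Prop := fun x => x.1 = 0 ∨ x.1 = ((sch.side k : ℕ) : ZMod (2 * sch.side k));
       let Γ : Fin 4 → T → T → Matrix (Fin 4) (Fin 4) ℂ :=
         fun μ x y => if (μ = 0 ∨ μ = 1) ∧ (wall x ∨ wall y) then (if μ = 0 then γn else -γn) else euclideanGamma μ;
       let D : C → Matrix I I ℂ := fun U => Matrix.reindex e e (Matrix.of fun v w =>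
         if v.1 = w.1 then
           ((if v.2 = w.2 then ((sch.mq v.1 k + 4 : ℝ) : ℂ) else 0) -
             (1 / 2 : ℂ) * ∑ μ : Fin 4,
               ((if w.2.1 = v.2.1 + TiltedTorus.step μ then
                   (1 - Γ μ v.2.1 w.2.1) v.2.2.2 w.2.2.2 * ρ (U (v.2.1, μ)) v.2.2.1 w.2.2.1 else 0) +
                (if v.2.1 = w.2.1 + TiltedTorus.step μ then
                   (1 + Γ μ v.2.1 w.2.1) v.2.2.2 w.2.2.2 * ρ ((U (w.2.1, μ))⁻¹) v.2.2.1 w.2.2.1 else 0)))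
         else 0);
       let boltz : C → A := fun U => grassmannExp (quadratic ℂ (-D U));
       let P : Fin Nf → Fin Nf → T → A := fun fl g x =>
         ∑ a : Fin 3, ∑ α : Fin 4, ∑ β : Fin 4,
           (Complex.I * gammaFive α β) • (psiBar ℂ (e (fl, (x, a, α))) * psi ℂ (e (g, (x, a, β))));
       let ins : C → QCDField Nf → Site 4 → A := fun U s x =>
         let y := TiltedTorus.proj (sch.side k) x;
         match s with
         | .glue => algebraMap ℂ A ((actionDensity ρ (configShift (-x) (TiltedTorus.lift (sch.side k) U)) : ℝ) : ℂ)
         | .pseudoRe fl g => (1 / 2 : ℂ) • (P fl g y + P g fl y)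
         | .pseudoIm fl g => (-Complex.I / 2) • (P fl g y - P g fl y);
       let sm : C → QCDField Nf → SchwartzMap E ℝ → A := fun U s h =>
         ∑ x ∈ box 4 (sch.L k), ((sch.z s k * sch.a k ^ 4 * h (sch.a k • siteToE x) : ℝ) : ℂ) •
           (ins U s x - algebraMap ℂ A ((sch.shift s k : ℝ) : ℂ));
       let wt : C → ℂ := fun U => ((TiltedTorus.weight ρ (sch.β k) U : ℝ) : ℂ);
       let ber := GrassmannAlgebra.berezin ℂ (I ⊕ₗ I);
       let ν := (TiltedTorus.haar (sch.side k) : Measure C);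
       if n = 0 then (1 : ℂ) else
         (∫ U, ber ((List.ofFn fun i => sm U (σ i) (f i)).prod * boltz U) * wt U ∂ν) /
           (∫ U, ber (boltz U) * wt U ∂ν))

/-- The coordinate swap `x₀ ↔ x₁` on real test functions, `h ↦ h ∘ swap` (VERBATIM the `swapT` of the items). -/
def swapTest (h : 𝓢(E4, ℝ)) : 𝓢(E4, ℝ) :=
  SchwartzMap.compCLMOfContinuousLinearEquiv ℝ
    (LinearIsometryEquiv.piLpCongrLeft 2 ℝ ℝ (Equiv.swap (0 : Fin 4) 1)).toContinuousLinearEquiv h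

/-- **Swap Gram form** of a one-step real-tensor functional `Λ₁` on a finite family: term `(i, j)` pairs the string `i`
REVERSED, REFLECTED (`swapTest`) and with reversed labels against the string `j` — the lattice shadow of OS's
`𝔖(Θfᵢ* ⊗ fⱼ)` for real tensors, complex coefficients `cᵢ`. -/
def gram {ι : Type} (Λ₁ : (n : ℕ) → (Fin n → ι) → (Fin n → 𝓢(E4, ℝ)) → ℂ) (N : ℕ) (c : Fin N → ℂ) (deg : Fin N → ℕ)
    (lab : (j : Fin N) → Fin (deg j) → ι) (f : (j : Fin N) → Fin (deg j) → 𝓢(E4, ℝ)) : ℂ :=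
  ∑ i, ∑ j, starRingEnd ℂ (c i) * c j *
    Λ₁ (deg i + deg j) (Fin.append (lab i ∘ Fin.rev) (lab j)) (Fin.append (fun l => swapTest (f i (Fin.rev l))) (f j))

/-- **The hypothesis package of `WallTransparency`** (the clauses of the route's `W` it keeps: the OS package of `S`, the scheme
triple AF / physical branch / honest convergence to `S`, and the two gaps; translations and signed permutations of `S` are dropped —
honest limits have them anyway). -/
def TPkg (Nf : ℕ) (sch : QCDScheme Nf) (S : LabelledSchwingerFamily (QCDField Nf) E4) : Prop :=
  let E := EuclideanSpace ℝ (Fin 4);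
  (S.IsNormalized ∧ S.IsHermitian ∧ S.HasLinearGrowth ∧ S.IsReflectionPositive ∧ S.IsSymmetric ∧ S.HasClusterProperty) ∧
    (sch.HasAsymptoticScaling ∧ (∀ fl : Fin Nf, ∀ᶠ k in Filter.atTop, -1 < sch.mq fl k) ∧
      (∀ (n : ℕ), n ≠ 0 → ∀ (σ : Fin n → QCDField Nf) (f : Fin n → SchwartzMap E ℝ) (F : SchwartzMap (Fin n → E) ℂ),
        IsTensorOf F (fun i => ofRealTest (f i)) → IsOffDiagonal F →
          Filter.Tendsto (fun k : ℕ => qcdLatticeSchwinger sch k n σ f) Filter.atTop (nhds (S n σ F)))) ∧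
    (∃ Δ : ℝ, 0 < Δ ∧ S.HasMassGap Δ ∧ sch.HasLatticeMassGap Δ)

/-- The package `W Nf sch S` of the route (VERBATIM): E0, E0', E2, E3, E4, translations, proper signed permutations on `⁰𝒮`;
two-loop AF, physical branch, honest convergence; continuum + uniform lattice gap. -/
def WPkg (Nf : ℕ) (sch : QCDScheme Nf) (S : LabelledSchwingerFamily (QCDField Nf) E4) : Prop :=
  let E := EuclideanSpace ℝ (Fin 4);
  ((S.IsNormalized ∧ S.IsHermitian ∧ S.HasLinearGrowth ∧ S.IsReflectionPositive ∧ S.IsSymmetric ∧ S.HasClusterProperty ∧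
      (∀ (n : ℕ) (k : Fin n → QCDField Nf) (a : E) (F : SchwartzMap (Fin n → E) ℂ), IsOffDiagonal F → S n k (translateMulti a F) = S n k F) ∧
      (∀ (n : ℕ) (k : Fin n → QCDField Nf) (R : E ≃ₗᵢ[ℝ] E), LinearMap.det (R.toLinearEquiv : E →ₗ[ℝ] E) = 1 →
        (∀ i : Fin 4, ∃ j : Fin 4, R (EuclideanSpace.single i 1) = EuclideanSpace.single j 1 ∨ R (EuclideanSpace.single i 1) = -EuclideanSpace.single j 1) →
          ∀ F : SchwartzMap (Fin n → E) ℂ, IsOffDiagonal F → S n k (linActMulti R F) = S n k F)) ∧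
    (sch.HasAsymptoticScaling ∧ (∀ fl : Fin Nf, ∀ᶠ k in Filter.atTop, -1 < sch.mq fl k) ∧
      (∀ (n : ℕ), n ≠ 0 → ∀ (σ : Fin n → QCDField Nf) (f : Fin n → SchwartzMap E ℝ) (F : SchwartzMap (Fin n → E) ℂ),
        IsTensorOf F (fun i => ofRealTest (f i)) → IsOffDiagonal F →
          Filter.Tendsto (fun k : ℕ => qcdLatticeSchwinger sch k n σ f) Filter.atTop (nhds (S n σ F)))) ∧
    (∃ Δ : ℝ, 0 < Δ ∧ S.HasMassGap Δ ∧ sch.HasLatticeMassGap Δ))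

/-! ## §1 The registered stubs -/

/-- Abbreviation: the slab-ordered compact real products of the YangMills sibling (LANDED dense class). -/
abbrev SOCP (n : ℕ) : Set 𝓢((Fin n → E4), ℂ) :=
  Summit.QuantumFields.YangMills.Cruxes.DiagonalMirrorRPR.ParityBridgeColdTraces.RpClosure.slabOrderedCompactProducts 4 n

/-- Hypotheses of the piece on `(S, Λ)`: E0 of `S`, degree-0 normalisation of the approximants, convergence on compact disjoint real
tensors (`n ≠ 0`), eventual swap Gram positivity on compact families in `{x₁ < x₀}` (VERBATIM the item's clauses). -/
def ApproxData {ι : Type} (S : LabelledSchwingerFamily ι E4)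
    (Λ : ℕ → (n : ℕ) → (Fin n → ι) → (Fin n → 𝓢(E4, ℝ)) → ℂ) : Prop :=
  S.IsNormalized ∧
    (∀ (k : ℕ) (σ : Fin 0 → ι) (f : Fin 0 → 𝓢(E4, ℝ)), Λ k 0 σ f = 1) ∧
      (∀ (n : ℕ), n ≠ 0 → ∀ (σ : Fin n → ι) (f : Fin n → 𝓢(E4, ℝ)), (∀ i, HasCompactSupport (f i : E4 → ℝ)) →
        (∀ i j, i ≠ j → Disjoint (tsupport (f i : E4 → ℝ)) (tsupport (f j : E4 → ℝ))) →
          ∀ F : 𝓢((Fin n → E4), ℂ), IsTensorOf F (fun i => ofRealTest (f i)) →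
            Tendsto (fun k : ℕ => Λ k n σ f) atTop (𝓝 (S n σ F))) ∧
        (∀ (N : ℕ) (c : Fin N → ℂ) (deg : Fin N → ℕ) (lab : (j : Fin N) → Fin (deg j) → ι)
          (f : (j : Fin N) → Fin (deg j) → 𝓢(E4, ℝ)),
          (∀ j l, HasCompactSupport (f j l : E4 → ℝ) ∧ tsupport (f j l : E4 → ℝ) ⊆ {y : E4 | y 1 < y 0}) →
            ∀ᶠ k in atTop, 0 ≤ (gram (Λ k) N c deg lab f).re ∧ (gram (Λ k) N c deg lab f).im = 0)

/-- Gram positivity of a labelled family `S'` on slab-ordered compact real product families (witness form). -/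
def ProductPSD {ι : Type} (S' : LabelledSchwingerFamily ι E4) : Prop :=
  ∀ (N : ℕ) (coef : Fin N → ℂ) (deg : Fin N → ℕ) (lab : (j : Fin N) → Fin (deg j) → ι)
    (P : (j : Fin N) → 𝓢((Fin (deg j) → E4), ℂ)), (∀ j, P j ∈ SOCP (deg j)) →
      ∀ H : (i j : Fin N) → 𝓢((Fin (deg i + deg j) → E4), ℂ),
        (∀ i j, IsAppendTensorOf (H i j) (osAdjoint (P i)) (P j)) →
          let z := ∑ i, ∑ j, starRingEnd ℂ (coef i) * coef j * S' (deg i + deg j) (Fin.append (lab i ∘ Fin.rev) (lab j)) (H i j)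
          0 ≤ z.re ∧ z.im = 0

/-- **(M) THE LIMIT STEP.** Approximant data force Gram positivity of the pulled-back family on slab-ordered compact real products
in every canonical diagonal frame. -/
theorem stub_productPSD :
    ∀ (ι : Type) (S : LabelledSchwingerFamily ι E4) (Λ : ℕ → (n : ℕ) → (Fin n → ι) → (Fin n → 𝓢(E4, ℝ)) → ℂ),
      ApproxData S Λ → ∀ (R : E4 ≃ₗᵢ[ℝ] E4) (c : ℝ), c ^ 2 = 1 / 2 → 0 < c →
        R (EuclideanSpace.single 0 1) = c • EuclideanSpace.single 0 1 + (-c) • EuclideanSpace.single 1 1 →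
          ProductPSD (fun n (k : Fin n → ι) => (S n k).comp (linActMulti R)) := by
  sorry

/-- **(M) THE DENSITY STEP, any labelled family.** Gram positivity on slab-ordered compact real product families implies E2. -/
theorem stub_rpOfProductPSD :
    ∀ (ι : Type) (S' : LabelledSchwingerFamily ι E4), ProductPSD S' → S'.IsReflectionPositive := by
  sorry

/-! ## §2 The piece, VERBATIM the route item, and the PROVED composition -/

/-- VERBATIM the statement filed as route item `TransparentRPWall.DiagonalRPClosure`. -/
def DiagonalRPClosureStmt : Prop :=
  open Literature.MathematicalPhysics.QuantumLattice Literature.MathematicalPhysics.AQFT Literature.MathematicalPhysics.QuantumFieldTheory Literature.Probability.LatticeModels in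
  let E := EuclideanSpace ℝ (Fin 4);
  let swapT : SchwartzMap E ℝ → SchwartzMap E ℝ := fun h =>
    SchwartzMap.compCLMOfContinuousLinearEquiv ℝ
      (LinearIsometryEquiv.piLpCongrLeft 2 ℝ ℝ (Equiv.swap (0 : Fin 4) 1)).toContinuousLinearEquiv h;
  ∀ (ι : Type) (S : LabelledSchwingerFamily ι E) (Λ : (ℕ → (n : ℕ) → (Fin n → ι) → (Fin n → SchwartzMap E ℝ) → ℂ)),
    S.IsNormalized →
    (∀ (n : ℕ) (k : Fin n → ι) (R : E ≃ₗᵢ[ℝ] E), LinearMap.det (R.toLinearEquiv : E →ₗ[ℝ] E) = 1 →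
      (∀ i : Fin 4, ∃ j : Fin 4, R (EuclideanSpace.single i 1) = EuclideanSpace.single j 1 ∨ R (EuclideanSpace.single i 1) = -EuclideanSpace.single j 1) →
        ∀ F : SchwartzMap (Fin n → E) ℂ, IsOffDiagonal F → S n k (linActMulti R F) = S n k F) →
    (∀ (k : ℕ) (σ : Fin 0 → ι) (f : Fin 0 → SchwartzMap E ℝ), Λ k 0 σ f = 1) →
    (∀ (n : ℕ), n ≠ 0 → ∀ (σ : Fin n → ι) (f : Fin n → SchwartzMap E ℝ), (∀ i, HasCompactSupport (f i : E → ℝ)) →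
        (∀ i j, i ≠ j → Disjoint (tsupport (f i : E → ℝ)) (tsupport (f j : E → ℝ))) →
          ∀ F : SchwartzMap (Fin n → E) ℂ, IsTensorOf F (fun i => ofRealTest (f i)) →
            Filter.Tendsto (fun k : ℕ => Λ k n σ f) Filter.atTop (nhds (S n σ F))) →
      (∀ (N : ℕ) (c : Fin N → ℂ) (deg : Fin N → ℕ) (lab : (j : Fin N) → Fin (deg j) → ι)
        (f : (j : Fin N) → Fin (deg j) → SchwartzMap E ℝ),
        (∀ j l, HasCompactSupport (f j l : E → ℝ) ∧ tsupport (f j l : E → ℝ) ⊆ {y : E | y 1 < y 0}) →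
          ∀ᶠ k in Filter.atTop,
            let z := ∑ i, ∑ j, starRingEnd ℂ (c i) * c j *
              Λ k (deg i + deg j) (Fin.append (lab i ∘ Fin.rev) (lab j))
                (Fin.append (fun l => swapT (f i (Fin.rev l))) (f j));
            0 ≤ z.re ∧ z.im = 0) →
        ∀ (R : E ≃ₗᵢ[ℝ] E) (a b : ℝ), a ^ 2 = 1 / 2 → b ^ 2 = 1 / 2 →
          R (EuclideanSpace.single 0 1) = a • EuclideanSpace.single 0 1 + b • EuclideanSpace.single 1 1 →
            LabelledSchwingerFamily.IsReflectionPositive (fun n (k : Fin n → ι) => (S n k).comp (linActMulti R))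

/-- **The piece from its stubs (PROVED)**: canonical frames `R e₀ = c (e₀ − e₁)`, `c > 0`, by the two stubs; every diagonal
frame by the LANDED frame normal form (a proper sign flip `P` with `(R.trans P) e₀ = c (e₀ − e₁)`) and transport back along the
proper-hypercubic invariance of `S` on `⁰𝒮` (LANDED `CurvatureChannel.linActMulti_trans` /
`isOffDiagonal_linActMulti_of_isAppendTensorOf`). -/
theorem DiagonalRPClosure_of_stubs
    (hLim : ∀ (ι : Type) (S : LabelledSchwingerFamily ι E4) (Λ : ℕ → (n : ℕ) → (Fin n → ι) → (Fin n → 𝓢(E4, ℝ)) → ℂ),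
      ApproxData S Λ → ∀ (R : E4 ≃ₗᵢ[ℝ] E4) (c : ℝ), c ^ 2 = 1 / 2 → 0 < c →
        R (EuclideanSpace.single 0 1) = c • EuclideanSpace.single 0 1 + (-c) • EuclideanSpace.single 1 1 →
          ProductPSD (fun n (k : Fin n → ι) => (S n k).comp (linActMulti R)))
    (hDen : ∀ (ι : Type) (S' : LabelledSchwingerFamily ι E4), ProductPSD S' → S'.IsReflectionPositive) :
    DiagonalRPClosureStmt := by
  intro ι S Λ hE0 hhyp h0 hconv hrp R a b ha hb hR
  -- (1) frame normal form (LANDED, YangMills sibling)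
  obtain ⟨P, c, hc, hc0, hdet, hsp, hframe⟩ :=
    Summit.QuantumFields.YangMills.Cruxes.DiagonalMirrorRPR.ParityBridgeColdTraces.RpClosure.frame_normal_form ha hb hR
  -- (2) the canonical frame `R.trans P`
  have hcan : LabelledSchwingerFamily.IsReflectionPositive
      (fun n (k : Fin n → ι) => (S n k).comp (linActMulti (R.trans P))) :=
    hDen ι _ (hLim ι S Λ ⟨hE0, h0, hconv, hrp⟩ (R.trans P) c hc hc0 hframe)
  -- (3) transport back to `R`
  intro N deg lab F hF H hH
  have h' := hcan N deg lab F hF H hH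
  have hkey : ∀ i j, S (deg i + deg j) (Fin.append (lab i ∘ Fin.rev) (lab j)) (linActMulti (R.trans P) (H i j)) =
      S (deg i + deg j) (Fin.append (lab i ∘ Fin.rev) (lab j)) (linActMulti R (H i j)) := by
    intro i j
    rw [Summit.QuantumFields.YangMills.Theorems.CurvatureChannel.linActMulti_trans]
    exact hhyp _ _ P hdet hsp _
      (Summit.QuantumFields.YangMills.Theorems.CurvatureChannel.isOffDiagonal_linActMulti_of_isAppendTensorOf R (hF i) (hF j) (hH i j))
  simp only [ContinuousLinearMap.comp_apply, hkey] at h'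
  simpa only [ContinuousLinearMap.comp_apply] using h'

/-- The local verbatim copy IS the route item (definitional). -/
theorem diagonalRPClosureStmt_iff :
    DiagonalRPClosureStmt ↔ Summit.QuantumFields.QCD.Theses.TransparentRPWall.DiagonalRPClosure := Iff.rfl

/-- **`DiagonalRPClosure_of`**: the registered stubs imply the ROUTE ITEM BY NAME. -/
theorem DiagonalRPClosure_of :
    (∀ (ι : Type) (S : LabelledSchwingerFamily ι E4) (Λ : ℕ → (n : ℕ) → (Fin n → ι) → (Fin n → 𝓢(E4, ℝ)) → ℂ),
      ApproxData S Λ → ∀ (R : E4 ≃ₗᵢ[ℝ] E4) (c : ℝ), c ^ 2 = 1 / 2 → 0 < c →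
        R (EuclideanSpace.single 0 1) = c • EuclideanSpace.single 0 1 + (-c) • EuclideanSpace.single 1 1 →
          ProductPSD (fun n (k : Fin n → ι) => (S n k).comp (linActMulti R))) →
    (∀ (ι : Type) (S' : LabelledSchwingerFamily ι E4), ProductPSD S' → S'.IsReflectionPositive) →
    Summit.QuantumFields.QCD.Theses.TransparentRPWall.DiagonalRPClosure :=
  fun h₁ h₂ => diagonalRPClosureStmt_iff.1 (DiagonalRPClosure_of_stubs h₁ h₂)

/-- **`DiagonalRPClosure_proof`**: the route item from the registered stubs (closed modulo the two `stub_*`). -/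
theorem DiagonalRPClosure_proof : Summit.QuantumFields.QCD.Theses.TransparentRPWall.DiagonalRPClosure :=
  DiagonalRPClosure_of stub_productPSD stub_rpOfProductPSD

end Summit.QuantumFields.QCD.Cruxes.WallDiagonalRP.DiagonalRPClosureBirth

end
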